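import Summits.HodgeConjecture.HodgeConjecture.Theorems.CyclicUnitaryPowersVeryGeneralDeckCommutatorsInHg
import Literature.AlgebraicGeometry.HodgeTheory.GoursatKolchinRibetHolds
import HarnessLib

/-!
# Crux K1 `VeryGeneralDeckCommutatorsInHg` (route `CyclicUnitaryPowers`, stmt-HodgeConjecture-19544): the Katz fact
# binder `stub_katzGKR` is PROVED modulo the classification of `Aut 𝔰𝔩ₙ`; K1 modulo six geometric facts + Jacobson

The registered skeleton v9 of the crux binds the Goursat–Kolchin–Ribet criterion
`Literature.AlgebraicGeometry.HodgeTheory.Katz1990_goursatKolchinRibet_specialLinear'` (Katz 1990, Prop. 1.8.2) as the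
stub `stub_katzGKR`, and the crux is closed modulo seven cited facts
(`CyclicUnitaryPowersVeryGeneralDeckCommutatorsInHg.veryGeneralDeckCommutatorsInHg_of_facts`).  The Katz fact is now a
THEOREM of the tree modulo ONE smaller cited fact, the classification of the automorphisms of `𝔰𝔩ₙ(ℂ)`
(`Literature.Algebra.Lie.SpecialLinearAutomorphisms.Jacobson1962_sl_automorphisms`, Jacobson, *Lie Algebras*, IX §5
Thm 5): `Literature/AlgebraicGeometry/HodgeTheory/GoursatKolchinRibetHolds.lean`,
`Katz1990_goursatKolchinRibet_specialLinear'_of_jacobson` (proof = Katz's: block kernels and Artin IV.4.9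
(`GoursatKolchinRibetKernels`), "`G°` maps onto `Gᵢ°`" (`GoursatKolchinRibetProjections`), logarithms of lifted
transvections and the Lie algebra (`Literature/NumberTheory/Automorphic/{LieAlgebraGLUnipotentLog, BlockDiagonalLieAlgebra}`,
`GoursatKolchinRibetLieAlgebra`), Ribet's lemma and `Aut 𝔰𝔩ₙ` (`GoursatKolchinRibetLieCore`), Schur twists
(`GoursatKolchinRibetTwist`)).  This file records, for the crux's registry and the debt queue:

* `stub_katzGKR_of_jacobson : Jacobson1962_sl_automorphisms → Katz1990_goursatKolchinRibet_specialLinear'` (the stub's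
  exact signature behind the one remaining fact), and
* `veryGeneralDeckCommutatorsInHg_of_facts_of_jacobson` — **K1 conditional on the six geometric / Hodge-II facts
  (Carlson–Toledo ×4, Cattani–Deligne–Kaplan, André) and Jacobson's theorem**, the Katz fact eliminated.

The unconditional `stub_katzGKR` follows the moment `Jacobson1962_sl_automorphisms_holds` lands (prover-Bx, in flight).
Written by the prover seat `hodge-nonav-prover-Ax` (g3). Nothing here says HC ∕ HC_AV is proved.

## References
* [Katz1990ESDE] N. M. Katz, Ann. of Math. Stud. 124 (1990), §1.8 Prop. 1.8.2.
* [Jacobson1962LieAlgebras] N. Jacobson, *Lie Algebras* (1962), Ch. IX §5 Theorem 5.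
* [CarlsonToledo1999] J. A. Carlson, D. Toledo, Duke Math. J. 97 (1999), Theorem 7.1.
-/

noncomputable section

open Literature.AlgebraicGeometry.Motives Literature.AlgebraicGeometry.HodgeTheory

-- mandated namespace `Summit.HodgeConjecture.HodgeConjecture.Theorems` trips `linter.dupNamespace` (off tree-wide)
set_option linter.dupNamespace false

namespace Summit.HodgeConjecture.HodgeConjecture.Theorems.CyclicUnitaryPowersKatzGKROfJacobson

/-- **Stub `stub_katzGKR` of crux K1 modulo Jacobson's theorem**: the Goursat–Kolchin–Ribet criterion
`Katz1990_goursatKolchinRibet_specialLinear'` (Katz 1990, Prop. 1.8.2, special case `Gᵢ^{0,der} = SL(Vᵢ)`, on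
`ℂ`-points) follows from the classification of the automorphisms of `𝔰𝔩ₙ(ℂ)`
(`Katz1990_goursatKolchinRibet_specialLinear'_of_jacobson`). [cite: Katz1990ESDE, §1.8 Prop. 1.8.2]
[cite: Jacobson1962LieAlgebras, Ch. IX §5 Theorem 5 (p. 283)] -/
theorem stub_katzGKR_of_jacobson
    (hJ : Literature.Algebra.Lie.SpecialLinearAutomorphisms.Jacobson1962_sl_automorphisms.{0, 0}) :
    Literature.AlgebraicGeometry.HodgeTheory.Katz1990_goursatKolchinRibet_specialLinear' :=
  Katz1990_goursatKolchinRibet_specialLinear'_of_jacobson hJ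

/-- **Crux K1 `VeryGeneralDeckCommutatorsInHg` modulo the six geometric / Hodge-II facts and Jacobson's theorem**
(the Katz fact of `veryGeneralDeckCommutatorsInHg_of_facts` replaced by its proof from
`Jacobson1962_sl_automorphisms`): for a very general smooth member of the cyclic family, every commutator of two
`σ`-unitary rational automorphisms of `H²` lies in the Hodge group. [cite: CarlsonToledo1999, §7 Theorem 7.1 (p. 16)]
[cite: Katz1990ESDE, §1.8 Prop. 1.8.2] [cite: Jacobson1962LieAlgebras, Ch. IX §5 Theorem 5 (p. 283)] -/
theorem veryGeneralDeckCommutatorsInHg_of_facts_of_jacobson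
    (hCT : nonempty_carlsonToledoFamily) (hCT1 : carlsonToledo1999_finrank_eigenspace_deck_one)
    (hCT2 : carlsonToledo1999_finrank_eigenspace_inf_hodgePiece)
    (hCDK : cmsp_nonHodgeGenericPoints_countable_algebraic_cover)
    (hAndre : andre1992_algebraicMonodromy_normal_mumfordTateGroup)
    (hCTd : carlsonToledo1999_unitaryReflection_zariskiDense)
    (hJ : Literature.Algebra.Lie.SpecialLinearAutomorphisms.Jacobson1962_sl_automorphisms.{0, 0}) :
    Summit.HodgeConjecture.HodgeConjecture.Theses.CyclicUnitaryPowers.VeryGeneralDeckCommutatorsInHg :=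
  CyclicUnitaryPowersVeryGeneralDeckCommutatorsInHg.veryGeneralDeckCommutatorsInHg_of_facts @hCT @hCT1 @hCT2 @hCDK
    @hAndre @hCTd @(stub_katzGKR_of_jacobson hJ)

end Summit.HodgeConjecture.HodgeConjecture.Theorems.CyclicUnitaryPowersKatzGKROfJacobson

end
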